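import Literature.NumberTheory.Transcendental.ZilberSaturation
import Literature.NumberTheory.Transcendental.ZilberGenericClosedness
import Literature.NumberTheory.Transcendental.ZilberFieldHomogeneity
import Mathlib.Algebra.Algebra.Hom.Rat
import HarnessLib

/-!
# Γ-isomorphisms over `K`: transfer, the field `K(α)`, predimension invariance, point embeddings

Toolkit for the proof of Bays–Kirby 2018, Prop. 11.2 (`Literature.NumberTheory.Transcendental.BaysKirby2018_prop_11_2`,
`ZilberGenericClosedness.lean`), exponential case inside a fixed exponential field `F`
(M. Bays, J. Kirby, *Pseudo-exponential maps, variants, and quasiminimality*, Algebra & Number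
Theory 12 (2018), §3, §4.1 and §11). Everything here is proved. Contents, by section:

* **The linear part of a Γ-isomorphism** (`namespace Literature.GammaField`):
  `IsGammaIso.transport` (def) — the `ℚ`-linear map `K + ℚx → K + ℚx'` underlying a
  Γ-isomorphism `x ↦ x'` over `K` (`GammaField.IsGammaIso`, i.e. the field isomorphism
  `IsGammaIso.fieldEquiv` of `ZilberSaturation.lean` restricted to `K + ℚx`), as a total function on
  `F` (junk `0` outside `K + ℚx`); it fixes `K`, sends `xᵢ ↦ x'ᵢ`, is additive and `ℚ`-linear and
  commutes with `exp` (`transport_add_sum_smul`, `coe_fieldEquiv_exp`).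
* **Transfer** : `IsGammaIso.transfer` — if `y` is any finite tuple from `K + ℚx` then
  `y ↦ transport y` is again a Γ-isomorphism over `K` (Bays–Kirby Def. 3.10/3.15: the Γ-field of
  `y` is a Γ-subfield of that of `x`); `sup_span_transport_eq` — the generated subspaces
  correspond when `x` is in turn in `K + ℚy`.
* **Γ-closed bases** (`GammaField.IsGammaClosed`, Def. 4.9): `IsGammaClosed.mem_of_mem_acl`
  (`acl (gens K) ⊆ K`), `IsGammaClosed.mem_of_exp_mem_acl` (`K` contains every logarithm of an
  element algebraic over `K₀`), `mem_of_exp_eq_one` (the kernel), `coe_fieldOf` (`K₀ = K` as sets)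
  and `isAlgClosed_fieldOf` (`K₀` is algebraically closed when `F` is).
* **The field `K(α)`**: `adjoinPtField K c` (abbrev) — `K(α) = K₀(c, exp c)` as an intermediate
  field over `K₀` (`= IntermediateField.adjoin K₀ (range (lvGens 0 c))`, the fraction field of the
  level-`0` algebra `lvAlgebra K 0 c`); `toSubfield_adjoinPtField` : its subfield is
  `GammaField.adjoinPt K c` of `ZilberGenericClosedness.lean`; `acl_gens_sup_span_eq_acl_adjoinPtField`,
  `td_sup_span_eq_relRank_adjoinPtField` (the Γ-field `⟨K c⟩` is algebraic over `K(α)`).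
  `IsGammaIso.lvEquiv h M` (def) — a *chosen* level-`M` algebra isomorphism of a Γ-isomorphism
  (`IsGammaIso` is `∀ M, ∃ σ_M, …`; `ZilberSaturation.lean` works instead with the glued maps
  `IsGammaIso.lvHom / adjoinHom / adjoinEquiv / fieldEquiv`); `IsGammaIso.adjoinPtEquiv h` (def) —
  the isomorphism `σ₀ : K(α) ≅ K(α')`, extension of `lvEquiv h 0` to fraction fields;
  `ringHom_adjoinPtField_ext` (two ring homomorphisms `K(α) → F` fixing `K₀` and agreeing on
  `c, exp c` are equal) and `IsGammaIso.coe_fieldEquiv_eq_adjoinPtEquiv` (**compatibility**: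
  `fieldEquiv` restricts to `σ₀` on `K(α)`), `coe_adjoinPtEquiv_symm_eq` (`σ₀⁻¹` is the `σ₀` of
  `h.symm`), `coe_adjoinPtEquiv_symm_mem_sup` (`σ₀⁻¹` maps `K + ℚc'` into `K + ℚc`).
* **Linear independence over `K`** (`GammaField.LinIndepOver`): `LinIndepOver.append_single`,
  `LinIndepOver.of_sup_span_eq`, `IsGammaIso.linIndepOver`.
* **Relative rank under injective maps** (`namespace Literature.MatroidComap`): `comap_contract`,
  `relRank_comap` (for Mathlib's `Matroid.comap` and the tree's `Matroid.relRank`),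
  `algebraicIndependent_matroid_eq_comap` and `relRank_image_ringHom` — relative transcendence rank
  in the algebraic matroid is invariant under injective ring homomorphisms of `ℚ`-algebras.
* **Γ-isomorphisms preserve predimension**: `IsGammaIso.coe_fieldEquiv_symm_eq`,
  `transport_symm_transport`, `image_fieldEquiv_preimage_gens`, `IsGammaIso.td_eq_of_transport`
  (`td` is invariant when the subspaces correspond under the transport maps), and for appended
  tuples `(c, e) ↦ (c', e')`: `transport_sum_smul_right`, `transport_mem_left`,
  `transport_mem_sup_sup`, `IsGammaIso.td_sup_span_eq`, `LinIndepOver.right_of_append`,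
  `ldim_span_eq_of_linIndepOver`, `IsGammaIso.predim_sup_span_eq` (`δ(e'/K + ℚc') = δ(e/K + ℚc)`,
  under linear independence of `(c, e)` over `K` — the case used for Prop. 11.2).
* **Point embeddings** (`ZilberHomogeneity.aevalCod_surjective`, `mem_ker_aevalCod_iff` extend
  `ZilberHomogeneity.aevalCod` of `ZilberFieldHomogeneity.lean`; then `namespace Literature.GammaField`):
  `pointHom σ b b' hle` (def) — the ring homomorphism `k[b] → L` along a base embedding
  `σ : k → L` with `b ↦ b'`, defined when `I(b/k)^σ` vanishes at `b'`; `pointFieldHom σ b b' hiff`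
  (def) — its extension to the fraction field `k(b) = IntermediateField.adjoin k (range b)` when the
  ideals correspond; with `_algebraMap`, `_apply_self`, `_apply_aeval`, `_injective` lemmas. (More
  general than `GammaField.exists_algEquiv_adjoin_of_ker_eq` of `ZilberSaturation.lean`: arbitrary
  base embedding, ideal inclusion.)

## References

* M. Bays, J. Kirby, *Pseudo-exponential maps, variants, and quasiminimality*, Algebra & Number
  Theory 12 (2018) 493–549: Def. 3.8, Def. 3.10, Def. 3.15, Def. 4.1, Def. 4.9, Lemma 4.10,
  Def. 11.1.
-/

noncomputable section

open Set

namespace Literature.NumberTheory.Transcendental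

namespace GammaField

open Literature.ModelTheory.ExponentialFields.ExponentialRing

variable {F : Type*} [Field F] [CharZero F] [Literature.ModelTheory.ExponentialFields.ExponentialRing F]
variable {K : Submodule ℚ F} {N : ℕ} {x x' : Fin N → F}

/-! ### The linear part of a Γ-isomorphism -/

/-- Elements of `K + ℚc` lie in the Γ-field `K₀(allGens c)`. [folklore] -/
theorem mem_adjoinField_of_mem_sup {c : Fin N → F} {z : F}
    (hz : z ∈ K ⊔ Submodule.span ℚ (range c)) :
    z ∈ IntermediateField.adjoin (fieldOf K) (allGens c) :=
  mem_adjoinField_of_mem_adjoin (mem_adjoin_allGens_of_mem hz)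

open Classical in
/-- **The transport map of a Γ-isomorphism** `x ↦ x'` over `K`: on `K + ℚx` it is the field
isomorphism `θ : ⟨K x⟩ ≅ ⟨K x'⟩` (`IsGammaIso.fieldEquiv`), elsewhere `0` (junk value).
[cite: BaysKirby2018ANT, Def. 3.10] -/
def IsGammaIso.transport (_h : IsGammaIso K x x') (z : F) : F :=
  if hz : z ∈ K ⊔ Submodule.span ℚ (range x) then
    ((_h.fieldEquiv ⟨z, mem_adjoinField_of_mem_sup hz⟩ :
      IntermediateField.adjoin (fieldOf K) (allGens x')) : F)
  else 0

/-- On `K + ℚx` the transport map is the field isomorphism `θ`. [folklore] -/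
theorem IsGammaIso.transport_eq (h : IsGammaIso K x x') {z : F}
    (hz : z ∈ K ⊔ Submodule.span ℚ (range x)) :
    h.transport z = (h.fieldEquiv ⟨z, mem_adjoinField_of_mem_sup hz⟩ : F) := by
  classical
  simp only [IsGammaIso.transport, dif_pos hz]

/-- `θ` evaluated at an element of `K + ℚx`, with any membership proof. [folklore] -/
theorem IsGammaIso.coe_fieldEquiv_eq_transport (h : IsGammaIso K x x') {z : F}
    (hz : z ∈ K ⊔ Submodule.span ℚ (range x))
    (hz' : z ∈ IntermediateField.adjoin (fieldOf K) (allGens x)) :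
    (h.fieldEquiv ⟨z, hz'⟩ : F) = h.transport z := by
  rw [h.transport_eq hz]

/-- The transport of an element of `K + ℚx` lies in `K + ℚx'`. [cite: BaysKirby2018ANT, Def. 3.10] -/
theorem IsGammaIso.transport_mem (h : IsGammaIso K x x') {z : F}
    (hz : z ∈ K ⊔ Submodule.span ℚ (range x)) :
    h.transport z ∈ K ⊔ Submodule.span ℚ (range x') := by
  rw [h.transport_eq hz]
  exact (h.fieldEquiv_exp hz).1

/-- The transport map commutes with `exp` on `K + ℚx`. [cite: BaysKirby2018ANT, Def. 3.10] -/
theorem IsGammaIso.coe_fieldEquiv_exp (h : IsGammaIso K x x') {z : F}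
    (hz : z ∈ K ⊔ Submodule.span ℚ (range x))
    (hez : exp z ∈ IntermediateField.adjoin (fieldOf K) (allGens x)) :
    (h.fieldEquiv ⟨exp z, hez⟩ : F) = exp (h.transport z) := by
  rw [h.transport_eq hz]
  exact (h.fieldEquiv_exp hz).2

/-- The transport map is additive on `K + ℚx`. [folklore] -/
theorem IsGammaIso.transport_add (h : IsGammaIso K x x') {z w : F}
    (hz : z ∈ K ⊔ Submodule.span ℚ (range x)) (hw : w ∈ K ⊔ Submodule.span ℚ (range x)) :
    h.transport (z + w) = h.transport z + h.transport w := by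
  rw [h.transport_eq hz, h.transport_eq hw, h.transport_eq (add_mem hz hw)]
  have : (⟨z + w, mem_adjoinField_of_mem_sup (add_mem hz hw)⟩ :
      IntermediateField.adjoin (fieldOf K) (allGens x)) =
      ⟨z, mem_adjoinField_of_mem_sup hz⟩ + ⟨w, mem_adjoinField_of_mem_sup hw⟩ := rfl
  rw [this, map_add]
  rfl

/-- The transport map fixes `K₀` pointwise (on `K + ℚx`). [folklore] -/
theorem IsGammaIso.transport_of_mem_fieldOf (h : IsGammaIso K x x') {z : F}
    (hzK : z ∈ fieldOf K) (hz : z ∈ K ⊔ Submodule.span ℚ (range x)) :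
    h.transport z = z := by
  rw [h.transport_eq hz]
  exact h.coe_fieldEquiv_algebraMap ⟨z, hzK⟩

/-- The transport map fixes `K` pointwise. [folklore] -/
theorem IsGammaIso.transport_of_mem (h : IsGammaIso K x x') {z : F} (hz : z ∈ K) :
    h.transport z = z :=
  h.transport_of_mem_fieldOf (mem_fieldOf_of_mem hz) (Submodule.mem_sup_left hz)

/-- The transport map is multiplicative against `K₀` on `K + ℚx`. [folklore] -/
theorem IsGammaIso.transport_mul_of_mem_fieldOf (h : IsGammaIso K x x') {k z : F}
    (hk : k ∈ fieldOf K) (hz : z ∈ K ⊔ Submodule.span ℚ (range x))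
    (hkz : k * z ∈ K ⊔ Submodule.span ℚ (range x)) :
    h.transport (k * z) = k * h.transport z := by
  rw [h.transport_eq hz, h.transport_eq hkz]
  have : (⟨k * z, mem_adjoinField_of_mem_sup hkz⟩ :
      IntermediateField.adjoin (fieldOf K) (allGens x)) =
      ⟨k, (IntermediateField.adjoin (fieldOf K) (allGens x)).algebraMap_mem ⟨k, hk⟩⟩ *
        ⟨z, mem_adjoinField_of_mem_sup hz⟩ := rfl
  rw [this, map_mul]
  show ((h.fieldEquiv _ : IntermediateField.adjoin (fieldOf K) (allGens x')) : F) * _ = _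
  rw [h.coe_fieldEquiv_algebraMap ⟨k, hk⟩]

/-- The transport map is `ℚ`-linear on `K + ℚx`. [folklore] -/
theorem IsGammaIso.transport_smul (h : IsGammaIso K x x') (q : ℚ) {z : F}
    (hz : z ∈ K ⊔ Submodule.span ℚ (range x)) :
    h.transport (q • z) = q • h.transport z := by
  rw [Rat.smul_def, Rat.smul_def]
  refine h.transport_mul_of_mem_fieldOf ?_ hz ?_
  · exact ((fieldOf K).algebraMap_mem (q : ℚ) : ((algebraMap ℚ F q) ∈ fieldOf K))
  · rw [← Rat.smul_def]; exact Submodule.smul_mem _ _ hz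

/-- The transport map sends `xᵢ ↦ x'ᵢ`. [folklore] -/
theorem IsGammaIso.transport_apply (h : IsGammaIso K x x') (i : Fin N) :
    h.transport (x i) = x' i := by
  have hxi : x i ∈ K ⊔ Submodule.span ℚ (range x) :=
    Submodule.mem_sup_right (Submodule.subset_span (mem_range_self i))
  rw [h.transport_eq hxi]
  have := h.coe_fieldEquiv_lvGens 0 (Sum.inl i)
  simpa only [lvGens_inl] using this

/-- The transport of `κ + ∑ qᵢ • xᵢ` (`κ ∈ K`) is `κ + ∑ qᵢ • x'ᵢ`. [folklore] -/
theorem IsGammaIso.transport_add_sum_smul (h : IsGammaIso K x x') {κ : F} (hκ : κ ∈ K)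
    (q : Fin N → ℚ) :
    h.transport (κ + ∑ i, q i • x i) = κ + ∑ i, q i • x' i := by
  have hxi : ∀ i, x i ∈ K ⊔ Submodule.span ℚ (range x) := fun i =>
    Submodule.mem_sup_right (Submodule.subset_span (mem_range_self i))
  have hsum : ∀ s : Finset (Fin N), (∑ i ∈ s, q i • x i) ∈ K ⊔ Submodule.span ℚ (range x) :=
    fun s => Submodule.sum_mem _ fun i _ => Submodule.smul_mem _ _ (hxi i)
  rw [h.transport_add (Submodule.mem_sup_left hκ) (hsum _), h.transport_of_mem hκ]
  congr 1
  induction (Finset.univ : Finset (Fin N)) using Finset.induction_on with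
  | empty =>
    rw [Finset.sum_empty, Finset.sum_empty]
    exact h.transport_of_mem (zero_mem K)
  | insert i s hi ih =>
    rw [Finset.sum_insert hi, Finset.sum_insert hi,
      h.transport_add (Submodule.smul_mem _ _ (hxi i)) (hsum s), ih,
      h.transport_smul (q i) (hxi i), h.transport_apply]

/-! ### Transfer of Γ-isomorphisms along re-basings -/

omit [Literature.ModelTheory.ExponentialFields.ExponentialRing F] in
/-- A tuple from `K + ℚx` generates, with `K`, a subspace of `K + ℚx`. [folklore] -/
theorem sup_span_le_of_forall_mem {m : ℕ} {y : Fin m → F}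
    (hy : ∀ j, y j ∈ K ⊔ Submodule.span ℚ (range x)) :
    K ⊔ Submodule.span ℚ (range y) ≤ K ⊔ Submodule.span ℚ (range x) :=
  sup_le le_sup_left (Submodule.span_le.2 (by rintro _ ⟨j, rfl⟩; exact hy j))

/-- The Γ-field of a tuple from `K + ℚx` is a Γ-subfield of `⟨K x⟩`. [cite: BaysKirby2018ANT, Def. 3.15] -/
theorem adjoinField_allGens_le_of_forall_mem {m : ℕ} {y : Fin m → F}
    (hy : ∀ j, y j ∈ K ⊔ Submodule.span ℚ (range x)) :
    IntermediateField.adjoin (fieldOf K) (allGens y) ≤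
      IntermediateField.adjoin (fieldOf K) (allGens x) := by
  refine IntermediateField.adjoin_le_iff.2 ?_
  rintro s ⟨_, ⟨M, rfl⟩, ⟨j, rfl⟩⟩
  cases j with
  | inl j =>
    rw [lvGens_inl]
    exact mem_adjoinField_of_mem_sup (hy j)
  | inr j =>
    simp only [lvGens_inr]
    exact exp_mem_adjoinField_of_mem
      (sup_span_le_of_forall_mem hy (div_factorial_mem_sup_span K y M j))

/-- **Transfer of a Γ-isomorphism to a tuple from `K + ℚx`.** If `x ↦ x'` is a Γ-isomorphism
over `K` and `y` is a finite tuple from `K + ℚx`, then `y ↦ θ(y)` is a Γ-isomorphism over `K`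
(the Γ-subfield of `⟨K x⟩` generated by `y` is mapped by `θ` isomorphically onto the Γ-subfield
of `⟨K x'⟩` generated by `θ(y)`). [cite: BaysKirby2018ANT, Def. 3.10, Def. 3.15] -/
theorem IsGammaIso.transfer (h : IsGammaIso K x x') {m : ℕ} {y : Fin m → F}
    (hy : ∀ j, y j ∈ K ⊔ Submodule.span ℚ (range x)) :
    IsGammaIso K y (fun j => h.transport (y j)) := by
  classical
  set Ey := IntermediateField.adjoin (fieldOf K) (allGens y) with hEy
  set Ex := IntermediateField.adjoin (fieldOf K) (allGens x) with hEx
  set Ex' := IntermediateField.adjoin (fieldOf K) (allGens x') with hEx'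
  have hle : Ey ≤ Ex := adjoinField_allGens_le_of_forall_mem hy
  let θ : Ey →+* F :=
    ((algebraMap Ex' F).comp (h.fieldEquiv : Ex →+* Ex')).comp
      (IntermediateField.inclusion hle : Ey →+* Ex)
  have hθ : ∀ (z : F) (hz : z ∈ Ey), θ ⟨z, hz⟩ = (h.fieldEquiv ⟨z, hle hz⟩ : F) := fun z hz => rfl
  have hsub := sup_span_le_of_forall_mem hy
  refine isGammaIso_of_ringHom θ (fun k => ?_) (fun j => ?_) (fun z hz => ?_)
  · rw [hθ]; exact h.coe_fieldEquiv_algebraMap k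
  · rw [hθ, h.coe_fieldEquiv_eq_transport (hy j)]
  · rw [hθ, hθ, h.coe_fieldEquiv_exp (hsub hz), h.coe_fieldEquiv_eq_transport (hsub hz)]

/-- The transported tuple lies in `K + ℚx'`. [folklore] -/
theorem IsGammaIso.transport_mem_of_forall_mem (h : IsGammaIso K x x') {m : ℕ} {y : Fin m → F}
    (hy : ∀ j, y j ∈ K ⊔ Submodule.span ℚ (range x)) (j : Fin m) :
    h.transport (y j) ∈ K ⊔ Submodule.span ℚ (range x') :=
  h.transport_mem (hy j)

/-- **The generated subspaces correspond.** If moreover `x` lies in `K + ℚy`, then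
`K + ℚθ(y) = K + ℚx'`. [folklore] -/
theorem IsGammaIso.sup_span_transport_eq (h : IsGammaIso K x x') {m : ℕ} {y : Fin m → F}
    (hy : ∀ j, y j ∈ K ⊔ Submodule.span ℚ (range x))
    (hx : ∀ i, x i ∈ K ⊔ Submodule.span ℚ (range y)) :
    K ⊔ Submodule.span ℚ (range fun j => h.transport (y j)) =
      K ⊔ Submodule.span ℚ (range x') := by
  refine le_antisymm (sup_span_le_of_forall_mem fun j => h.transport_mem (hy j)) ?_
  refine sup_span_le_of_forall_mem fun i => ?_
  -- write `x i = κ + ∑ q j • y j`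
  obtain ⟨κ, hκ, s, hs, hxs⟩ := Submodule.mem_sup.1 (hx i)
  obtain ⟨q, rfl⟩ := (Submodule.mem_span_range_iff_exists_fun ℚ).1 hs
  have hxi : x i ∈ K ⊔ Submodule.span ℚ (range x) :=
    Submodule.mem_sup_right (Submodule.subset_span (mem_range_self i))
  have key : x' i = κ + ∑ j, q j • h.transport (y j) := by
    rw [← h.transport_apply i, ← hxs]
    have hsum : ∀ t : Finset (Fin m), (∑ j ∈ t, q j • y j) ∈ K ⊔ Submodule.span ℚ (range x) :=
      fun t => Submodule.sum_mem _ fun j _ => Submodule.smul_mem _ _ (hy j)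
    rw [h.transport_add (Submodule.mem_sup_left hκ) (hsum _), h.transport_of_mem hκ]
    congr 1
    induction (Finset.univ : Finset (Fin m)) using Finset.induction_on with
    | empty =>
      rw [Finset.sum_empty, Finset.sum_empty]
      exact h.transport_of_mem (zero_mem K)
    | insert j t hj ih =>
      rw [Finset.sum_insert hj, Finset.sum_insert hj,
        h.transport_add (Submodule.smul_mem _ _ (hy j)) (hsum t), ih, h.transport_smul (q j) (hy j)]
  rw [key]
  refine add_mem (Submodule.mem_sup_left hκ) (Submodule.mem_sup_right ?_)
  exact Submodule.sum_mem _ fun j _ =>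
    Submodule.smul_mem _ _ (Submodule.subset_span (mem_range_self j))

/-! ### Γ-closed bases -/

section GammaClosedBase

variable {K : Submodule ℚ F}

/-- Over a Γ-closed `K`, an element outside `K` generates an extension with `td = 2`.
[cite: BaysKirby2018ANT, Def. 4.9] -/
theorem IsGammaClosed.td_span_singleton_eq_two (hK : IsGammaClosed K) {z : F} (hz : z ∉ K) :
    td K (Submodule.span ℚ {z}) = 2 := by
  refine GammaField.td_span_singleton_eq_two hz (le_antisymm (predim_span_singleton_le hz) ?_)
  have h1 := hK.one_le_predim (le_sup_left : K ≤ K ⊔ Submodule.span ℚ {z})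
    (isFG_sup_left.2 (isFG_span_of_finite K (Set.finite_singleton z))) (fun heq => hz ?_)
  · rwa [predim_sup_left] at h1
  · have : z ∈ K ⊔ Submodule.span ℚ {z} :=
      Submodule.mem_sup_right (Submodule.mem_span_singleton_self z)
    rwa [heq] at this

/-- **A Γ-closed `K` is relatively algebraically closed**: every element of `F` algebraic over
the Γ-subfield `K₀ = ℚ(K, exp K)` lies in `K` (`δ(z/K) ≤ 0` for such `z`).
[cite: BaysKirby2018ANT, Def. 4.9, Lemma 4.10] -/
theorem IsGammaClosed.mem_of_mem_acl (hK : IsGammaClosed K) {z : F} (hz : z ∈ acl (gens K)) :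
    z ∈ K := by
  by_contra hzK
  exact (not_mem_acl_of_td_eq_two (hK.td_span_singleton_eq_two hzK)).1 hz

/-- **A Γ-closed `K` contains all logarithms of elements algebraic over `K₀`**: if `exp z` is
algebraic over `K₀` then `z ∈ K` (`δ(z/K) ≤ 0`). In particular `ker exp ⊆ K`.
[cite: BaysKirby2018ANT, Def. 4.9, Lemma 4.10] -/
theorem IsGammaClosed.mem_of_exp_mem_acl (hK : IsGammaClosed K) {z : F}
    (hz : exp z ∈ acl (gens K)) : z ∈ K := by
  by_contra hzK
  exact (not_mem_acl_of_td_eq_two (hK.td_span_singleton_eq_two hzK)).2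
    (acl_mono (subset_insert _ _) hz)

/-- The kernel of `exp` lies in every Γ-closed `K`. [cite: BaysKirby2018ANT, Lemma 4.10] -/
theorem IsGammaClosed.mem_of_exp_eq_one (hK : IsGammaClosed K) {z : F} (hz : exp z = 1) :
    z ∈ K :=
  hK.mem_of_exp_mem_acl (hz ▸ one_mem_acl _)

/-- Two logarithms of the same element differ by an element of a Γ-closed `K`. [folklore] -/
theorem IsGammaClosed.sub_mem_of_exp_eq (hK : IsGammaClosed K) {z w : F} (h : exp z = exp w) :
    z - w ∈ K := by
  refine hK.mem_of_exp_eq_one ?_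
  rw [sub_eq_add_neg, exp_add, exp_neg_eq_inv, h, mul_inv_cancel₀ (exp_ne_zero w)]

/-- **For a Γ-closed `K`, the Γ-subfield `K₀ = ℚ(K, exp K)` is `K` itself** (as a set).
[cite: BaysKirby2018ANT, Def. 4.9] -/
theorem IsGammaClosed.coe_fieldOf (hK : IsGammaClosed K) : ((fieldOf K : Set F)) = K := by
  refine Subset.antisymm (fun z hz => hK.mem_of_mem_acl (fieldOf_subset_acl K hz)) ?_
  exact fun z hz => mem_fieldOf_of_mem hz

/-- Membership form of `IsGammaClosed.coe_fieldOf`. [folklore] -/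
theorem IsGammaClosed.mem_fieldOf_iff (hK : IsGammaClosed K) {z : F} : z ∈ fieldOf K ↔ z ∈ K := by
  rw [← SetLike.mem_coe, hK.coe_fieldOf, SetLike.mem_coe]

/-- `exp` maps a Γ-closed `K` into `K`. [folklore] -/
theorem IsGammaClosed.exp_mem (hK : IsGammaClosed K) {z : F} (hz : z ∈ K) : exp z ∈ K :=
  hK.mem_fieldOf_iff.1 (exp_mem_fieldOf hz)

/-- `acl (gens K) = K` for a Γ-closed `K`. [folklore] -/
theorem IsGammaClosed.acl_gens_eq (hK : IsGammaClosed K) : acl (gens K) = K :=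
  Subset.antisymm (fun _ hz => hK.mem_of_mem_acl hz) ((subset_gens K).trans (subset_acl _))

/-- **`K₀` is algebraically closed** when `K` is Γ-closed in an algebraically closed `F`: a root in
`F` of a polynomial over `K₀` is algebraic over `K₀`, hence lies in `K = K₀`.
[cite: BaysKirby2018ANT, §11 ("Let `K` be a full Γ-field")] -/
theorem IsGammaClosed.isAlgClosed_fieldOf [IsAlgClosed F] (hK : IsGammaClosed K) :
    IsAlgClosed (fieldOf K) := by
  refine IsAlgClosed.of_exists_root _ fun p hmonic hirr => ?_
  have hdeg : (p.map (algebraMap (fieldOf K) F)).degree ≠ 0 := by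
    rw [Polynomial.degree_map]
    intro h0
    exact hirr.not_isUnit (Polynomial.isUnit_iff_degree_eq_zero.2 h0)
  obtain ⟨z, hz⟩ := IsAlgClosed.exists_root (p.map (algebraMap (fieldOf K) F)) hdeg
  have hz' : Polynomial.aeval z p = 0 := by
    rwa [Polynomial.aeval_def, Polynomial.eval₂_eq_eval_map]
  have halg : IsAlgebraic (fieldOf K) z := ⟨p, hmonic.ne_zero, hz'⟩
  have hzacl : z ∈ acl (gens K) := by
    rw [← acl_fieldOf]
    exact ZilberHomogeneity.mem_acl_of_isAlgebraic (fieldOf K).toSubalgebra halg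
  have hzK : z ∈ fieldOf K := mem_fieldOf_of_mem (hK.mem_of_mem_acl hzacl)
  refine ⟨⟨z, hzK⟩, ?_⟩
  apply (algebraMap (fieldOf K) F).injective
  rw [map_zero, ← Polynomial.eval₂_at_apply, ← Polynomial.eval_map]
  exact hz

end GammaClosedBase

/-! ### The level-`0` field `K(α) = K₀(c, exp c)` and the level-`0` isomorphism -/

section LevelZero

variable {K : Submodule ℚ F} {N : ℕ} {c c' : Fin N → F}

omit [CharZero F] in
/-- At level `0` the generators are `(c, exp c) = gammaPt c`. [folklore] -/
theorem lvGens_zero_eq_gammaPt (c : Fin N → F) : lvGens 0 c = gammaPt c := by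
  funext j
  rcases j with i | i
  · rfl
  · rw [lvGens_zero_inr]; rfl

variable (K) in
/-- **The field `K(α)`, `α = (c, exp c)`**, as an intermediate field over `K₀ = ℚ(K, exp K)`:
`K₀(c, exp c)`, the fraction field of the level-`0` algebra `K₀[c, exp c]`
(`GammaField.lvAlgebra K 0 c`). Its underlying subfield is `GammaField.adjoinPt K c`
(`toSubfield_adjoinPtField`). [cite: BaysKirby2018ANT, Def. 11.1 ("`V` is defined over `K(α)`")] -/
abbrev adjoinPtField (c : Fin N → F) : IntermediateField (fieldOf K) F :=
  IntermediateField.adjoin (fieldOf K) (range (lvGens 0 c))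

/-- `K(α)` is the subfield `adjoinPt K c`. [folklore] -/
theorem toSubfield_adjoinPtField (c : Fin N → F) : (adjoinPtField K c).toSubfield = adjoinPt K c := by
  rw [adjoinPtField, IntermediateField.adjoin_toSubfield, adjoinPt, lvGens_zero_eq_gammaPt]
  congr 2
  ext z
  constructor
  · rintro ⟨k, rfl⟩; exact k.2
  · intro hz; exact ⟨⟨z, hz⟩, rfl⟩

/-- Membership in `K(α)` is membership in `adjoinPt K c`. [folklore] -/
theorem mem_adjoinPtField_iff (c : Fin N → F) {z : F} : z ∈ adjoinPtField K c ↔ z ∈ adjoinPt K c := by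
  rw [← IntermediateField.mem_toSubfield, toSubfield_adjoinPtField]

/-- The level-`0` algebra lies in `K(α)`. [folklore] -/
theorem lvAlgebra_le_adjoinPtField (c : Fin N → F) :
    (lvAlgebra K 0 c : Subalgebra (fieldOf K) F) ≤ (adjoinPtField K c).toSubalgebra :=
  IntermediateField.algebra_adjoin_le_adjoin _ _

/-- The generators `cᵢ`, `exp cᵢ` lie in `K(α)`. [folklore] -/
theorem lvGens_zero_mem_adjoinPtField (c : Fin N → F) (j : Fin N ⊕ Fin N) : lvGens 0 c j ∈ adjoinPtField K c :=
  IntermediateField.subset_adjoin _ _ (mem_range_self j)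

/-- `cᵢ ∈ K(α)`. [folklore] -/
theorem apply_mem_adjoinPtField (c : Fin N → F) (i : Fin N) : c i ∈ adjoinPtField K c :=
  lvGens_zero_mem_adjoinPtField c (Sum.inl i)

/-- `exp cᵢ ∈ K(α)`. [folklore] -/
theorem exp_apply_mem_adjoinPtField (c : Fin N → F) (i : Fin N) : exp (c i) ∈ adjoinPtField K c := by
  have := lvGens_zero_mem_adjoinPtField (K := K) c (Sum.inr i)
  rwa [lvGens_zero_inr] at this

/-- `K₀ ⊆ K(α)`. [folklore] -/
theorem mem_adjoinPtField_of_mem_fieldOf (c : Fin N → F) {z : F} (hz : z ∈ fieldOf K) : z ∈ adjoinPtField K c :=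
  (adjoinPtField K c).algebraMap_mem ⟨z, hz⟩

/-- `K ⊆ K(α)`. [folklore] -/
theorem mem_adjoinPtField_of_mem_base (c : Fin N → F) {z : F} (hz : z ∈ K) : z ∈ adjoinPtField K c :=
  mem_adjoinPtField_of_mem_fieldOf c (mem_fieldOf_of_mem hz)

/-- `K + ℚc ⊆ K(α)`. [folklore] -/
theorem mem_adjoinPtField_of_mem_sup (c : Fin N → F) {z : F} (hz : z ∈ K ⊔ Submodule.span ℚ (range c)) :
    z ∈ adjoinPtField K c :=
  lvAlgebra_le_adjoinPtField c (by
    have := mem_adjoin_allGens_of_mem hz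
    obtain ⟨k, hk, y, hy, rfl⟩ := Submodule.mem_sup.1 hz
    refine Subalgebra.add_mem _ ((lvAlgebra K 0 c).algebraMap_mem ⟨k, mem_fieldOf_of_mem hk⟩) ?_
    obtain ⟨f, rfl⟩ := (Submodule.mem_span_range_iff_exists_fun ℚ).1 hy
    refine Subalgebra.sum_mem _ fun i _ => ?_
    rw [Rat.smul_def]
    refine Subalgebra.mul_mem _ ((lvAlgebra K 0 c).algebraMap_mem (f i : fieldOf K)) ?_
    exact lvGens_mem_lvAlgebra K 0 c (Sum.inl i))

/-- `K(α) ⊆ ⟨K c⟩ = K₀(allGens c)`. [folklore] -/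
theorem adjoinPtField_le_adjoinField (c : Fin N → F) :
    adjoinPtField K c ≤ IntermediateField.adjoin (fieldOf K) (allGens c) :=
  IntermediateField.adjoin.mono _ _ _ fun _ hz => mem_iUnion.2 ⟨0, hz⟩

/-- `K(α) ⊆ acl (gens (K + ℚc))`: the field `K(α)` is algebraic over (indeed generated by)
coordinates of `Γ(⟨K c⟩)`. [folklore] -/
theorem coe_adjoinPtField_subset_acl (c : Fin N → F) :
    ((adjoinPtField K c : Set F)) ⊆ acl (gens (K ⊔ Submodule.span ℚ (range c))) := by
  intro z hz
  rw [SetLike.mem_coe, mem_adjoinPtField_iff] at hz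
  exact (adjoinPt_le_fieldOf_sup K c).trans (fieldOf_subset_acl _) hz

/-- **The Γ-field `⟨K c⟩` is algebraic over `K(α)`**: `acl (gens (K + ℚc)) = acl (K(α))`, since
the division points `exp (cᵢ/M!)` are roots of `T^{M!} − exp cᵢ`. [cite: BaysKirby2018ANT, Def. 3.8] -/
theorem acl_gens_sup_span_eq_acl_adjoinPtField (c : Fin N → F) :
    acl (gens (K ⊔ Submodule.span ℚ (range c))) = acl ((adjoinPtField K c : Set F)) := by
  refine Subset.antisymm (acl_subset_acl_of_subset ?_) (acl_subset_acl_of_subset (coe_adjoinPtField_subset_acl c))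
  rintro z (hz | ⟨w, hw, rfl⟩)
  · exact subset_acl _ (mem_adjoinPtField_of_mem_sup c hz)
  · -- `exp w`, `w = k + ∑ qᵢ cᵢ`
    obtain ⟨k, hk, y, hy, rfl⟩ := Submodule.mem_sup.1 (hw : w ∈ K ⊔ Submodule.span ℚ (range c))
    rw [exp_add]
    refine mul_mem_acl (subset_acl _ (mem_adjoinPtField_of_mem_fieldOf c (exp_mem_fieldOf hk))) ?_
    obtain ⟨f, rfl⟩ := (Submodule.mem_span_range_iff_exists_fun ℚ).1 hy
    induction (Finset.univ : Finset (Fin N)) using Finset.induction_on with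
    | empty => rw [Finset.sum_empty, exp_zero]; exact one_mem_acl _
    | insert i s hi ih =>
      rw [Finset.sum_insert hi, exp_add]
      exact mul_mem_acl (exp_smul_mem_acl (f i) (subset_acl _ (exp_apply_mem_adjoinPtField c i))) ih

/-- `td` over `K + ℚc` is the relative rank over the field `K(α)`. [folklore] -/
theorem td_sup_span_eq_relRank_adjoinPtField (c : Fin N → F) (Λ' : Submodule ℚ F) :
    td (K ⊔ Submodule.span ℚ (range c)) Λ' =
      (algMatroid F).relRank ((adjoinPtField K c : Set F)) (gens Λ') := by
  rw [td_def]
  have h := acl_gens_sup_span_eq_acl_adjoinPtField (K := K) c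
  -- `relRank` is invariant under replacing the base by a set with the same closure
  have e1 : (algMatroid F).relRank (gens (K ⊔ Submodule.span ℚ (range c))) (gens Λ') =
      (algMatroid F).relRank (acl (gens (K ⊔ Submodule.span ℚ (range c)))) (gens Λ') :=
    ((algMatroid F).relRank_closure_left _ _).symm
  have e2 : (algMatroid F).relRank ((adjoinPtField K c : Set F)) (gens Λ') =
      (algMatroid F).relRank (acl ((adjoinPtField K c : Set F))) (gens Λ') :=
    ((algMatroid F).relRank_closure_left _ _).symm
  rw [e1, e2]
  exact congrArg (fun S => (algMatroid F).relRank S (gens Λ')) h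

/-! #### The level-`0` isomorphism `σ₀ : K(α) ≅ K(α')` of a Γ-isomorphism -/

/-- A chosen level-`M` isomorphism of a Γ-isomorphism. [folklore] -/
def IsGammaIso.lvEquiv (h : IsGammaIso K c c') (M : ℕ) :
    lvAlgebra K M c ≃ₐ[fieldOf K] lvAlgebra K M c' :=
  Classical.choose (h M)

/-- The chosen level-`M` isomorphism sends generators to generators. [folklore] -/
theorem IsGammaIso.coe_lvEquiv_lvGens (h : IsGammaIso K c c') (M : ℕ) (j : Fin N ⊕ Fin N) :
    (h.lvEquiv M ⟨lvGens M c j, lvGens_mem_lvAlgebra K M c j⟩ : F) = lvGens M c' j :=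
  Classical.choose_spec (h M) j

open scoped IntermediateField.algebraAdjoinAdjoin

/-- **The level-`0` isomorphism `σ₀ : K(α) ≅ K(α')`** of a Γ-isomorphism `c ↦ c'` over `K`: the
extension to fraction fields of the level-`0` algebra isomorphism `K₀[c, exp c] ≅ K₀[c', exp c']`.
[cite: BaysKirby2018ANT, Def. 3.10] -/
def IsGammaIso.adjoinPtEquiv (h : IsGammaIso K c c') : adjoinPtField K c ≃+* adjoinPtField K c' :=
  IsFractionRing.ringEquivOfRingEquiv (A := lvAlgebra K 0 c) (B := lvAlgebra K 0 c')
    (h.lvEquiv 0 : lvAlgebra K 0 c ≃+* lvAlgebra K 0 c')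

/-- `σ₀` extends the level-`0` algebra isomorphism. [folklore] -/
theorem IsGammaIso.coe_adjoinPtEquiv_of_mem (h : IsGammaIso K c c') {z : F}
    (hz : z ∈ lvAlgebra K 0 c) :
    (h.adjoinPtEquiv ⟨z, lvAlgebra_le_adjoinPtField c hz⟩ : F) = h.lvEquiv 0 ⟨z, hz⟩ := by
  have := IsFractionRing.ringEquivOfRingEquiv_algebraMap
    (A := lvAlgebra K 0 c) (K := adjoinPtField K c) (B := lvAlgebra K 0 c') (L := adjoinPtField K c')
    (h.lvEquiv 0 : lvAlgebra K 0 c ≃+* lvAlgebra K 0 c') ⟨z, hz⟩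
  exact congrArg Subtype.val this

/-- `σ₀` is the identity on `K₀`. [folklore] -/
theorem IsGammaIso.coe_adjoinPtEquiv_algebraMap (h : IsGammaIso K c c') (k : fieldOf K) :
    (h.adjoinPtEquiv ⟨k, (adjoinPtField K c).algebraMap_mem k⟩ : F) = k := by
  have hk : (k : F) ∈ lvAlgebra K 0 c := (lvAlgebra K 0 c).algebraMap_mem k
  rw [h.coe_adjoinPtEquiv_of_mem hk]
  have h2 : (⟨k, hk⟩ : lvAlgebra K 0 c) = algebraMap (fieldOf K) (lvAlgebra K 0 c) k := rfl
  rw [h2, AlgEquiv.commutes]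
  rfl

/-- `σ₀` is the identity on `K₀` (membership form). [folklore] -/
theorem IsGammaIso.coe_adjoinPtEquiv_of_mem_fieldOf (h : IsGammaIso K c c') {z : F}
    (hz : z ∈ fieldOf K) (hz' : z ∈ adjoinPtField K c) : (h.adjoinPtEquiv ⟨z, hz'⟩ : F) = z :=
  h.coe_adjoinPtEquiv_algebraMap ⟨z, hz⟩

/-- `σ₀ (c, exp c) = (c', exp c')` coordinatewise. [folklore] -/
theorem IsGammaIso.coe_adjoinPtEquiv_lvGens (h : IsGammaIso K c c') (j : Fin N ⊕ Fin N) :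
    (h.adjoinPtEquiv ⟨lvGens 0 c j, lvGens_zero_mem_adjoinPtField c j⟩ : F) = lvGens 0 c' j := by
  rw [h.coe_adjoinPtEquiv_of_mem (lvGens_mem_lvAlgebra K 0 c j)]
  exact h.coe_lvEquiv_lvGens 0 j

/-- `σ₀ cᵢ = c'ᵢ`. [folklore] -/
theorem IsGammaIso.coe_adjoinPtEquiv_apply (h : IsGammaIso K c c') (i : Fin N) :
    (h.adjoinPtEquiv ⟨c i, apply_mem_adjoinPtField c i⟩ : F) = c' i :=
  h.coe_adjoinPtEquiv_lvGens (Sum.inl i)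

/-- `σ₀ (exp cᵢ) = exp c'ᵢ`. [folklore] -/
theorem IsGammaIso.coe_adjoinPtEquiv_exp_apply (h : IsGammaIso K c c') (i : Fin N) :
    (h.adjoinPtEquiv ⟨exp (c i), exp_apply_mem_adjoinPtField c i⟩ : F) = exp (c' i) := by
  have := h.coe_adjoinPtEquiv_lvGens (Sum.inr i)
  simp only [lvGens_zero_inr] at this
  convert this using 3

/-- `σ₀ (gammaPt c) = gammaPt c'` coordinatewise. [folklore] -/
theorem IsGammaIso.coe_adjoinPtEquiv_gammaPt (h : IsGammaIso K c c') (j : Fin N ⊕ Fin N)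
    (hj : gammaPt c j ∈ adjoinPtField K c) :
    (h.adjoinPtEquiv ⟨gammaPt c j, hj⟩ : F) = gammaPt c' j := by
  rcases j with i | i
  · exact h.coe_adjoinPtEquiv_apply i
  · exact h.coe_adjoinPtEquiv_exp_apply i

/-! #### Uniqueness of homomorphisms on `K(α)` and compatibility with `θ` -/

/-- **Uniqueness**: two ring homomorphisms `K(α) → F` which fix `K₀` pointwise and agree on the
generators `cᵢ, exp cᵢ` are equal. [folklore] -/
theorem ringHom_adjoinPtField_ext {f g : adjoinPtField K c →+* F}
    (hf : ∀ k : fieldOf K, f (algebraMap (fieldOf K) (adjoinPtField K c) k) = k)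
    (hg : ∀ k : fieldOf K, g (algebraMap (fieldOf K) (adjoinPtField K c) k) = k)
    (h : ∀ j, f ⟨lvGens 0 c j, lvGens_zero_mem_adjoinPtField c j⟩ = g ⟨lvGens 0 c j, lvGens_zero_mem_adjoinPtField c j⟩) :
    f = g := by
  have := IntermediateField.adjoin_algHom_ext (fieldOf K) (s := range (lvGens 0 c))
    (φ₁ := ({ f with commutes' := hf } : adjoinPtField K c →ₐ[fieldOf K] F))
    (φ₂ := ({ g with commutes' := hg } : adjoinPtField K c →ₐ[fieldOf K] F)) (by
      rintro _ ⟨j, rfl⟩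
      exact h j)
  ext z
  exact congrArg (fun φ : adjoinPtField K c →ₐ[fieldOf K] F => φ z) this

/-- **`θ` restricts to `σ₀`**: on `K(α)` the field isomorphism `θ : ⟨K c⟩ ≅ ⟨K c'⟩` of a
Γ-isomorphism agrees with the level-`0` isomorphism `σ₀`. [folklore] -/
theorem IsGammaIso.coe_fieldEquiv_eq_adjoinPtEquiv (h : IsGammaIso K c c') {z : F}
    (hz : z ∈ adjoinPtField K c) :
    (h.fieldEquiv ⟨z, adjoinPtField_le_adjoinField c hz⟩ : F) = (h.adjoinPtEquiv ⟨z, hz⟩ : F) := by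
  let f : adjoinPtField K c →+* F :=
    ((algebraMap (IntermediateField.adjoin (fieldOf K) (allGens c')) F).comp
      (h.fieldEquiv : IntermediateField.adjoin (fieldOf K) (allGens c) →+*
        IntermediateField.adjoin (fieldOf K) (allGens c'))).comp
      ((IntermediateField.inclusion (adjoinPtField_le_adjoinField (K := K) c) :
        adjoinPtField K c →ₐ[fieldOf K] IntermediateField.adjoin (fieldOf K) (allGens c)) : adjoinPtField K c →+* _)
  let g : adjoinPtField K c →+* F := (algebraMap (adjoinPtField K c') F).comp (h.adjoinPtEquiv : adjoinPtField K c →+* adjoinPtField K c')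
  have hf : ∀ (w : F) (hw : w ∈ adjoinPtField K c), f ⟨w, hw⟩ = (h.fieldEquiv ⟨w, adjoinPtField_le_adjoinField c hw⟩ : F) :=
    fun _ _ => rfl
  have hg : ∀ (w : F) (hw : w ∈ adjoinPtField K c), g ⟨w, hw⟩ = (h.adjoinPtEquiv ⟨w, hw⟩ : F) := fun _ _ => rfl
  have hfg : f = g := by
    refine ringHom_adjoinPtField_ext (fun k => ?_) (fun k => ?_) (fun j => ?_)
    · rw [show algebraMap (fieldOf K) (adjoinPtField K c) k = ⟨k, (adjoinPtField K c).algebraMap_mem k⟩ from rfl, hf]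
      exact h.coe_fieldEquiv_algebraMap k
    · rw [show algebraMap (fieldOf K) (adjoinPtField K c) k = ⟨k, (adjoinPtField K c).algebraMap_mem k⟩ from rfl, hg]
      exact h.coe_adjoinPtEquiv_algebraMap k
    · rw [hf, hg, h.coe_adjoinPtEquiv_lvGens]
      exact h.coe_fieldEquiv_lvGens 0 j
  rw [← hf z hz, ← hg z hz, hfg]

/-- On `K(α) ∩ (K + ℚc)` the transport map is `σ₀`. [folklore] -/
theorem IsGammaIso.transport_eq_adjoinPtEquiv (h : IsGammaIso K c c') {z : F}
    (hz : z ∈ K ⊔ Submodule.span ℚ (range c)) :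
    h.transport z = (h.adjoinPtEquiv ⟨z, mem_adjoinPtField_of_mem_sup c hz⟩ : F) := by
  rw [h.transport_eq hz, ← h.coe_fieldEquiv_eq_adjoinPtEquiv]

/-- `σ₀⁻¹ c'ᵢ = cᵢ`. [folklore] -/
theorem IsGammaIso.coe_adjoinPtEquiv_symm_apply (h : IsGammaIso K c c') (i : Fin N) :
    (h.adjoinPtEquiv.symm ⟨c' i, apply_mem_adjoinPtField c' i⟩ : F) = c i := by
  have e : h.adjoinPtEquiv ⟨c i, apply_mem_adjoinPtField c i⟩ = ⟨c' i, apply_mem_adjoinPtField c' i⟩ :=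
    Subtype.ext (h.coe_adjoinPtEquiv_apply i)
  rw [← e, RingEquiv.symm_apply_apply]

/-- `σ₀⁻¹` is the identity on `K₀`. [folklore] -/
theorem IsGammaIso.coe_adjoinPtEquiv_symm_of_mem_fieldOf (h : IsGammaIso K c c') {z : F}
    (hz : z ∈ fieldOf K) : (h.adjoinPtEquiv.symm ⟨z, mem_adjoinPtField_of_mem_fieldOf c' hz⟩ : F) = z := by
  have e : h.adjoinPtEquiv ⟨z, mem_adjoinPtField_of_mem_fieldOf c hz⟩ = ⟨z, mem_adjoinPtField_of_mem_fieldOf c' hz⟩ :=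
    Subtype.ext (h.coe_adjoinPtEquiv_of_mem_fieldOf hz _)
  rw [← e, RingEquiv.symm_apply_apply]

/-- `σ₀⁻¹ (exp c'ᵢ) = exp cᵢ`. [folklore] -/
theorem IsGammaIso.coe_adjoinPtEquiv_symm_exp_apply (h : IsGammaIso K c c') (i : Fin N) :
    (h.adjoinPtEquiv.symm ⟨exp (c' i), exp_apply_mem_adjoinPtField c' i⟩ : F) = exp (c i) := by
  have e : h.adjoinPtEquiv ⟨exp (c i), exp_apply_mem_adjoinPtField c i⟩ = ⟨exp (c' i), exp_apply_mem_adjoinPtField c' i⟩ :=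
    Subtype.ext (h.coe_adjoinPtEquiv_exp_apply i)
  rw [← e, RingEquiv.symm_apply_apply]

/-- **`σ₀⁻¹` is the level-`0` isomorphism of the inverse Γ-isomorphism** (both fix `K₀` and send
`c' ↦ c`, `exp c' ↦ exp c`). [folklore] -/
theorem IsGammaIso.coe_adjoinPtEquiv_symm_eq (h : IsGammaIso K c c') (z : adjoinPtField K c') :
    (h.adjoinPtEquiv.symm z : F) = (h.symm.adjoinPtEquiv z : F) := by
  have key : (algebraMap (adjoinPtField K c) F).comp (h.adjoinPtEquiv.symm : adjoinPtField K c' →+* adjoinPtField K c) =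
      (algebraMap (adjoinPtField K c) F).comp (h.symm.adjoinPtEquiv : adjoinPtField K c' →+* adjoinPtField K c) := by
    refine ringHom_adjoinPtField_ext (fun k => ?_) (fun k => ?_) (fun j => ?_)
    · exact h.coe_adjoinPtEquiv_symm_of_mem_fieldOf k.2
    · exact h.symm.coe_adjoinPtEquiv_algebraMap k
    · show (h.adjoinPtEquiv.symm _ : F) = (h.symm.adjoinPtEquiv _ : F)
      rw [h.symm.coe_adjoinPtEquiv_lvGens]
      rcases j with i | i
      · exact h.coe_adjoinPtEquiv_symm_apply i
      · have e1 : (⟨lvGens 0 c' (Sum.inr i), lvGens_zero_mem_adjoinPtField c' (Sum.inr i)⟩ : adjoinPtField K c') =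
            ⟨exp (c' i), exp_apply_mem_adjoinPtField c' i⟩ := Subtype.ext (lvGens_zero_inr c' i)
        rw [e1, h.coe_adjoinPtEquiv_symm_exp_apply i, lvGens_zero_inr]
  exact congrArg (fun φ : adjoinPtField K c' →+* F => φ z) key

/-- **`σ₀⁻¹` maps `K + ℚc'` into `K + ℚc`.** [folklore] -/
theorem IsGammaIso.coe_adjoinPtEquiv_symm_mem_sup (h : IsGammaIso K c c') {z : F}
    (hz : z ∈ K ⊔ Submodule.span ℚ (range c')) :
    (h.adjoinPtEquiv.symm ⟨z, mem_adjoinPtField_of_mem_sup c' hz⟩ : F) ∈ K ⊔ Submodule.span ℚ (range c) := by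
  rw [h.coe_adjoinPtEquiv_symm_eq, ← h.symm.transport_eq_adjoinPtEquiv hz]
  exact h.symm.transport_mem hz

/-! ### Linear independence over `K` -/

omit [Literature.ModelTheory.ExponentialFields.ExponentialRing F] in
/-- Appending an element outside `K + ℚc` preserves linear independence over `K`. [folklore] -/
theorem LinIndepOver.append_single {c : Fin N → F} (h : LinIndepOver K c) {x : F}
    (hx : x ∉ K ⊔ Submodule.span ℚ (range c)) : LinIndepOver K (Fin.append c ![x]) := by
  intro q hq
  rw [Fin.sum_univ_add] at hq
  simp only [Fin.append_left, Fin.append_right, Fin.sum_univ_one, Matrix.cons_val_fin_one] at hq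
  set q₀ := q (Fin.natAdd N 0) with hq₀
  by_cases h0 : q₀ = 0
  · rw [h0, zero_smul, add_zero] at hq
    have h1 := h (fun i => q (Fin.castAdd 1 i)) hq
    funext s
    refine Fin.addCases (fun i => ?_) (fun j => ?_) s
    · exact congrFun h1 i
    · have : j = 0 := Subsingleton.elim _ _
      subst this
      exact h0
  · exfalso
    apply hx
    have : x = q₀⁻¹ • ((∑ i, q (Fin.castAdd 1 i) • c i + q₀ • x) - ∑ i, q (Fin.castAdd 1 i) • c i) := by
      rw [add_sub_cancel_left, smul_smul, inv_mul_cancel₀ h0, one_smul]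
    rw [this]
    refine Submodule.smul_mem _ _ (Submodule.sub_mem _ (Submodule.mem_sup_left hq) ?_)
    exact Submodule.mem_sup_right (Submodule.sum_mem _ fun i _ =>
      Submodule.smul_mem _ _ (Submodule.subset_span (mem_range_self i)))

omit [Literature.ModelTheory.ExponentialFields.ExponentialRing F] in
/-- Linear independence over `K` is invariant under re-basings preserving the generated
subspace: if `x` (independent over `K`) and `x̃` have the same length and
`K + ℚx = K + ℚx̃` then `x̃` is independent over `K`. [folklore] -/
theorem LinIndepOver.of_sup_span_eq {n : ℕ} {x x' : Fin n → F} (h : LinIndepOver K x)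
    (heq : K ⊔ Submodule.span ℚ (range x) = K ⊔ Submodule.span ℚ (range x')) :
    LinIndepOver K x' := by
  rw [linIndepOver_iff] at h ⊢
  -- the images in `F ⧸ K` span the same subspace, of dimension `n`
  have hspan : ∀ {y : Fin n → F}, Submodule.span ℚ (range (K.mkQ ∘ y)) =
      (K ⊔ Submodule.span ℚ (range y)).map K.mkQ := fun {y} => by
    rw [Submodule.map_sup, show K.map K.mkQ = ⊥ from map_mkQ_eq_bot_iff.2 le_rfl, bot_sup_eq,
      Submodule.map_span, ← range_comp]
  have hs : Submodule.span ℚ (range (K.mkQ ∘ x')) = Submodule.span ℚ (range (K.mkQ ∘ x)) := by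
    rw [hspan, hspan, heq]
  rw [linearIndependent_iff_card_eq_finrank_span, Set.finrank] at h ⊢
  rw [hs]
  exact h

/-- A Γ-isomorphism `c ↦ c'` over `K` transports linear independence over `K`. [folklore] -/
theorem IsGammaIso.linIndepOver (h : IsGammaIso K c c') (hc : LinIndepOver K c) :
    LinIndepOver K c' := by
  intro q hq
  have key : h.symm.transport (∑ i, q i • c' i) = ∑ i, q i • c i := by
    have := h.symm.transport_add_sum_smul (zero_mem K) q
    rwa [zero_add, zero_add] at this
  have h2 : h.symm.transport (∑ i, q i • c' i) = ∑ i, q i • c' i := h.symm.transport_of_mem hq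
  rw [h2] at key
  exact hc q (key ▸ hq)

end LevelZero

end GammaField

/-! ### Relative rank under injective maps of the ground set -/

namespace MatroidComap

variable {α β : Type*}

/-- **Contraction commutes with `comap` along an injective map.** [folklore] -/
theorem comap_contract (N : Matroid β) {f : α → β} (hf : Function.Injective f) (C : Set α) :
    (N.comap f).contract C = (N.contract (f '' C)).comap f := by
  obtain ⟨B, hB⟩ := (N.comap f).exists_isBasis' C
  obtain ⟨hB', -, -⟩ := Matroid.comap_isBasis'_iff.1 hB
  refine Matroid.ext_indep ?_ fun I _ => ?_
  · rw [Matroid.contract_ground, Matroid.comap_ground_eq, Matroid.comap_ground_eq,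
      Matroid.contract_ground, preimage_sdiff, preimage_image_eq _ hf]
  · rw [hB.contract_indep_iff, Matroid.comap_indep_iff, Matroid.comap_indep_iff,
      hB'.contract_indep_iff, image_union, disjoint_image_iff hf]
    constructor
    · rintro ⟨⟨h1, -⟩, h2⟩; exact ⟨⟨h1, h2⟩, hf.injOn⟩
    · rintro ⟨⟨h1, h2⟩, -⟩; exact ⟨⟨h1, hf.injOn⟩, h2⟩

/-- **Relative rank is computed in `comap` along an injective map.** [folklore] -/
theorem relRank_comap (N : Matroid β) {f : α → β} (hf : Function.Injective f) (C X : Set α) :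
    (N.comap f).relRank C X = N.relRank (f '' C) (f '' X) := by
  rw [Matroid.relRank_eq_eRk_contract, Matroid.relRank_eq_eRk_contract, comap_contract N hf,
    Matroid.eRk_comap]

/-- **The algebraic matroid of a subfield is the restriction of that of the field**: along an
injective ring homomorphism `f : E₁ → E₂` of `ℚ`-algebras, the algebraic matroid of `E₁` is the
`comap` of that of `E₂`. [folklore] -/
theorem algebraicIndependent_matroid_eq_comap {E₁ E₂ : Type*} [Field E₁] [Field E₂]
    [Algebra ℚ E₁] [Algebra ℚ E₂] (f : E₁ →+* E₂) (hf : Function.Injective f) :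
    AlgebraicIndependent.matroid ℚ E₁ = (AlgebraicIndependent.matroid ℚ E₂).comap f := by
  refine Matroid.ext_indep ?_ fun I _ => ?_
  · rw [Matroid.comap_ground_eq]
    simp [AlgebraicIndependent.matroid]
  · rw [Matroid.comap_indep_iff, AlgebraicIndependent.matroid_indep_iff,
      AlgebraicIndependent.matroid_indep_iff]
    change AlgebraicIndependent ℚ (fun i : I => (i : E₁)) ↔
      AlgebraicIndependent ℚ (fun i : f '' I => (i : E₂)) ∧ InjOn f I
    rw [← algebraicIndependent_image hf.injOn]
    constructor
    · intro h
      exact ⟨h.map' (f := f.toRatAlgHom) hf, hf.injOn⟩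
    · rintro ⟨h, -⟩
      exact AlgebraicIndependent.of_comp f.toRatAlgHom h

/-- **Relative transcendence rank is invariant under injective ring homomorphisms.**
[folklore] -/
theorem relRank_image_ringHom {E₁ E₂ : Type*} [Field E₁] [Field E₂] [Algebra ℚ E₁] [Algebra ℚ E₂]
    (f : E₁ →+* E₂) (hf : Function.Injective f) (A B : Set E₁) :
    (AlgebraicIndependent.matroid ℚ E₂).relRank (f '' A) (f '' B) =
      (AlgebraicIndependent.matroid ℚ E₁).relRank A B := by
  rw [algebraicIndependent_matroid_eq_comap f hf, relRank_comap _ hf]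

end MatroidComap

namespace GammaField

open Literature.ModelTheory.ExponentialFields.ExponentialRing

variable {F : Type*} [Field F] [CharZero F] [Literature.ModelTheory.ExponentialFields.ExponentialRing F]
variable {K : Submodule ℚ F} {N k : ℕ} {c c' : Fin N → F}

/-! ### Γ-isomorphisms preserve predimension -/

/-- `θ⁻¹` is the field isomorphism of the inverse Γ-isomorphism (both are `K₀`-linear and send
`lvGens M c' ↦ lvGens M c`). [folklore] -/
theorem IsGammaIso.coe_fieldEquiv_symm_eq (h : IsGammaIso K c c')
    (z : IntermediateField.adjoin (fieldOf K) (allGens c')) :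
    (h.fieldEquiv.symm z : F) = (h.symm.fieldEquiv z : F) := by
  let f : IntermediateField.adjoin (fieldOf K) (allGens c') →ₐ[fieldOf K] F :=
    { (algebraMap (IntermediateField.adjoin (fieldOf K) (allGens c)) F).comp
        (h.fieldEquiv.symm : _ →+* _) with
      commutes' := fun k => by
        show (h.fieldEquiv.symm (algebraMap (fieldOf K) _ k) : F) = k
        have e : h.fieldEquiv ⟨k, (IntermediateField.adjoin (fieldOf K) (allGens c)).algebraMap_mem k⟩ =
            ⟨k, (IntermediateField.adjoin (fieldOf K) (allGens c')).algebraMap_mem k⟩ :=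
          Subtype.ext (h.coe_fieldEquiv_algebraMap k)
        rw [show algebraMap (fieldOf K) (IntermediateField.adjoin (fieldOf K) (allGens c')) k =
          ⟨k, (IntermediateField.adjoin (fieldOf K) (allGens c')).algebraMap_mem k⟩ from rfl, ← e,
          RingEquiv.symm_apply_apply] }
  let g : IntermediateField.adjoin (fieldOf K) (allGens c') →ₐ[fieldOf K] F :=
    { (algebraMap (IntermediateField.adjoin (fieldOf K) (allGens c)) F).comp
        (h.symm.fieldEquiv : _ →+* _) with
      commutes' := fun k => by
        show (h.symm.fieldEquiv (algebraMap (fieldOf K) _ k) : F) = k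
        exact h.symm.coe_fieldEquiv_algebraMap k }
  have hfg : f = g := by
    refine IntermediateField.adjoin_algHom_ext (fieldOf K) ?_
    rintro _ ⟨_, ⟨M, rfl⟩, ⟨j, rfl⟩⟩
    show (h.fieldEquiv.symm _ : F) = (h.symm.fieldEquiv _ : F)
    rw [h.symm.coe_fieldEquiv_lvGens M j]
    have e : h.fieldEquiv ⟨lvGens M c j, mem_adjoinField_of_mem_adjoin
        (lvAlgebra_le_adjoin_allGens K M c (lvGens_mem_lvAlgebra K M c j))⟩ =
        ⟨lvGens M c' j, mem_adjoinField_of_mem_adjoin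
          (lvAlgebra_le_adjoin_allGens K M c' (lvGens_mem_lvAlgebra K M c' j))⟩ :=
      Subtype.ext (h.coe_fieldEquiv_lvGens M j)
    rw [show (⟨lvGens M c' j, IntermediateField.subset_adjoin _ _ ⟨_, ⟨M, rfl⟩, ⟨j, rfl⟩⟩⟩ :
        IntermediateField.adjoin (fieldOf K) (allGens c')) = ⟨lvGens M c' j, mem_adjoinField_of_mem_adjoin
          (lvAlgebra_le_adjoin_allGens K M c' (lvGens_mem_lvAlgebra K M c' j))⟩ from rfl, ← e,
      RingEquiv.symm_apply_apply]
  exact congrArg (fun φ : _ →ₐ[fieldOf K] F => φ z) hfg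

/-- The transport maps of `h` and `h.symm` are mutually inverse on `K + ℚc`. [folklore] -/
theorem IsGammaIso.transport_symm_transport (h : IsGammaIso K c c') {z : F}
    (hz : z ∈ K ⊔ Submodule.span ℚ (range c)) : h.symm.transport (h.transport z) = z := by
  rw [h.symm.transport_eq (h.transport_mem hz), ← h.coe_fieldEquiv_symm_eq]
  have e : (⟨h.transport z, mem_adjoinField_of_mem_sup (h.transport_mem hz)⟩ :
      IntermediateField.adjoin (fieldOf K) (allGens c')) = h.fieldEquiv ⟨z, mem_adjoinField_of_mem_sup hz⟩ :=
    Subtype.ext (h.transport_eq hz)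
  rw [e, RingEquiv.symm_apply_apply]

/-- `θ` maps the generators `gens (K + ℚc)` onto `gens (K + ℚc')`, as a statement about the
preimages in `⟨K c⟩`. [folklore] -/
theorem IsGammaIso.image_fieldEquiv_preimage_gens (h : IsGammaIso K c c') {Λ : Submodule ℚ F}
    {Λ' : Submodule ℚ F} (hΛ : Λ ≤ K ⊔ Submodule.span ℚ (range c))
    (hΛ' : Λ' ≤ K ⊔ Submodule.span ℚ (range c'))
    (hto : ∀ z ∈ Λ, h.transport z ∈ Λ') (hfrom : ∀ z ∈ Λ', h.symm.transport z ∈ Λ) :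
    (h.fieldEquiv : IntermediateField.adjoin (fieldOf K) (allGens c) → IntermediateField.adjoin (fieldOf K) (allGens c')) ''
        ((Subtype.val : IntermediateField.adjoin (fieldOf K) (allGens c) → F) ⁻¹' gens Λ) =
      (Subtype.val : IntermediateField.adjoin (fieldOf K) (allGens c') → F) ⁻¹' gens Λ' := by
  ext w
  simp only [mem_image, mem_preimage]
  constructor
  · rintro ⟨a, ha, rfl⟩
    rcases (mem_gens_iff.1 ha) with ha | ⟨d, hd, hda⟩
    · have e : a = ⟨(a : F), mem_adjoinField_of_mem_sup (hΛ ha)⟩ := Subtype.ext rfl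
      rw [e, h.coe_fieldEquiv_eq_transport (hΛ ha)]
      exact mem_gens_of_mem (hto _ ha)
    · have e : a = ⟨exp d, exp_mem_adjoinField_of_mem (hΛ hd)⟩ := Subtype.ext hda.symm
      rw [e, h.coe_fieldEquiv_exp (hΛ hd)]
      exact exp_mem_gens (hto _ hd)
  · intro hw
    refine ⟨h.fieldEquiv.symm w, ?_, RingEquiv.apply_symm_apply _ _⟩
    rcases (mem_gens_iff.1 hw) with hw | ⟨d, hd, hdw⟩
    · have e : w = ⟨(w : F), mem_adjoinField_of_mem_sup (hΛ' hw)⟩ := Subtype.ext rfl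
      rw [e, h.coe_fieldEquiv_symm_eq, h.symm.coe_fieldEquiv_eq_transport (hΛ' hw)]
      exact mem_gens_of_mem (hfrom _ hw)
    · have e : w = ⟨exp d, exp_mem_adjoinField_of_mem (hΛ' hd)⟩ := Subtype.ext hdw.symm
      rw [e, h.coe_fieldEquiv_symm_eq, h.symm.coe_fieldEquiv_exp (hΛ' hd)]
      exact exp_mem_gens (hfrom _ hd)

/-- **Γ-isomorphisms preserve transcendence degrees**: if `x ↦ x'` is a Γ-isomorphism over `K`
and `Λ₁, Λ₂ ≤ K + ℚx` correspond to `Λ₁', Λ₂' ≤ K + ℚx'` under the transport maps, then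
`td(Λ₂/Λ₁) = td(Λ₂'/Λ₁')` (the field isomorphism `θ` restricts to a bijection between the
generators, and relative transcendence rank is invariant under field isomorphisms).
[cite: BaysKirby2018ANT, Def. 3.10, Def. 4.1] -/
theorem IsGammaIso.td_eq_of_transport (h : IsGammaIso K c c') {Λ₁ Λ₂ Λ₁' Λ₂' : Submodule ℚ F}
    (h₁ : Λ₁ ≤ K ⊔ Submodule.span ℚ (range c)) (h₂ : Λ₂ ≤ K ⊔ Submodule.span ℚ (range c))
    (h₁' : Λ₁' ≤ K ⊔ Submodule.span ℚ (range c')) (h₂' : Λ₂' ≤ K ⊔ Submodule.span ℚ (range c'))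
    (hto₁ : ∀ z ∈ Λ₁, h.transport z ∈ Λ₁') (hfrom₁ : ∀ z ∈ Λ₁', h.symm.transport z ∈ Λ₁)
    (hto₂ : ∀ z ∈ Λ₂, h.transport z ∈ Λ₂') (hfrom₂ : ∀ z ∈ Λ₂', h.symm.transport z ∈ Λ₂) :
    td Λ₁ Λ₂ = td Λ₁' Λ₂' := by
  set E := IntermediateField.adjoin (fieldOf K) (allGens c) with hE
  set E' := IntermediateField.adjoin (fieldOf K) (allGens c') with hE'
  have hgens : ∀ {Λ : Submodule ℚ F}, Λ ≤ K ⊔ Submodule.span ℚ (range c) → gens Λ ⊆ (E : Set F) := by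
    intro Λ hΛ z hz
    rcases mem_gens_iff.1 hz with hz | ⟨d, hd, rfl⟩
    · exact mem_adjoinField_of_mem_sup (hΛ hz)
    · exact exp_mem_adjoinField_of_mem (hΛ hd)
  have hgens' : ∀ {Λ : Submodule ℚ F}, Λ ≤ K ⊔ Submodule.span ℚ (range c') → gens Λ ⊆ (E' : Set F) := by
    intro Λ hΛ z hz
    rcases mem_gens_iff.1 hz with hz | ⟨d, hd, rfl⟩
    · exact mem_adjoinField_of_mem_sup (hΛ hz)
    · exact exp_mem_adjoinField_of_mem (hΛ hd)
  have himg : ∀ {S : Set F}, S ⊆ (E : Set F) → (Subtype.val : E → F) '' (Subtype.val ⁻¹' S) = S :=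
    fun hS => image_preimage_eq_of_subset (by rwa [Subtype.range_coe])
  have himg' : ∀ {S : Set F}, S ⊆ (E' : Set F) → (Subtype.val : E' → F) '' (Subtype.val ⁻¹' S) = S :=
    fun hS => image_preimage_eq_of_subset (by rwa [Subtype.range_coe])
  rw [td_def, td_def, ← himg (hgens h₁), ← himg (hgens h₂), ← himg' (hgens' h₁'), ← himg' (hgens' h₂')]
  have r1 := MatroidComap.relRank_image_ringHom (algebraMap E F) (algebraMap E F).injective
    ((Subtype.val : E → F) ⁻¹' gens Λ₁) ((Subtype.val : E → F) ⁻¹' gens Λ₂)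
  have r2 := MatroidComap.relRank_image_ringHom (algebraMap E' F) (algebraMap E' F).injective
    ((Subtype.val : E' → F) ⁻¹' gens Λ₁') ((Subtype.val : E' → F) ⁻¹' gens Λ₂')
  have r3 := MatroidComap.relRank_image_ringHom (h.fieldEquiv : E →+* E') h.fieldEquiv.injective
    ((Subtype.val : E → F) ⁻¹' gens Λ₁) ((Subtype.val : E → F) ⁻¹' gens Λ₂)
  have i1 := h.image_fieldEquiv_preimage_gens h₁ h₁' hto₁ hfrom₁
  have i2 := h.image_fieldEquiv_preimage_gens h₂ h₂' hto₂ hfrom₂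
  change (algMatroid F).relRank ((algebraMap E F) '' _) ((algebraMap E F) '' _) =
    (algMatroid F).relRank ((algebraMap E' F) '' _) ((algebraMap E' F) '' _)
  rw [r1, r2, ← r3]
  change (AlgebraicIndependent.matroid ℚ E').relRank ((h.fieldEquiv : E → E') '' _) ((h.fieldEquiv : E → E') '' _) = _
  rw [i1, i2]

/-! #### Application to appended tuples -/

/-- The transport of a Γ-isomorphism `(c, e) ↦ (c', e')` sends `ℚe` into `ℚe'` hence
`(K + ℚc) + ℚe`-elements accordingly: `transport (∑ qⱼ eⱼ) = ∑ qⱼ e'ⱼ`. [folklore] -/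
theorem IsGammaIso.transport_sum_smul_right {e e' : Fin k → F}
    (h : IsGammaIso K (Fin.append c e) (Fin.append c' e')) (q : Fin k → ℚ) :
    h.transport (∑ j, q j • e j) = ∑ j, q j • e' j := by
  have := h.transport_add_sum_smul (zero_mem K) (Fin.append (0 : Fin N → ℚ) q)
  rw [zero_add, zero_add, Fin.sum_univ_add, Fin.sum_univ_add] at this
  simpa only [Fin.append_left, Fin.append_right, Pi.zero_apply, zero_smul, Finset.sum_const_zero,
    zero_add] using this

/-- The transport of `(c, e) ↦ (c', e')` sends `K + ℚc` into `K + ℚc'`. [folklore] -/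
theorem IsGammaIso.transport_mem_left {e e' : Fin k → F}
    (h : IsGammaIso K (Fin.append c e) (Fin.append c' e')) {z : F}
    (hz : z ∈ K ⊔ Submodule.span ℚ (range c)) : h.transport z ∈ K ⊔ Submodule.span ℚ (range c') := by
  obtain ⟨κ, hκ, y, hy, rfl⟩ := Submodule.mem_sup.1 hz
  obtain ⟨q, rfl⟩ := (Submodule.mem_span_range_iff_exists_fun ℚ).1 hy
  have := h.transport_add_sum_smul hκ (Fin.append q (0 : Fin k → ℚ))
  rw [Fin.sum_univ_add, Fin.sum_univ_add] at this
  simp only [Fin.append_left, Fin.append_right, Pi.zero_apply, zero_smul, Finset.sum_const_zero,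
    add_zero] at this
  rw [this]
  exact add_mem (Submodule.mem_sup_left hκ) (Submodule.mem_sup_right
    (Submodule.sum_mem _ fun i _ => Submodule.smul_mem _ _ (Submodule.subset_span (mem_range_self i))))

/-- The transport of `(c, e) ↦ (c', e')` sends `(K + ℚc) + ℚe` into `(K + ℚc') + ℚe'`. [folklore] -/
theorem IsGammaIso.transport_mem_sup_sup {e e' : Fin k → F}
    (h : IsGammaIso K (Fin.append c e) (Fin.append c' e')) {z : F}
    (hz : z ∈ (K ⊔ Submodule.span ℚ (range c)) ⊔ Submodule.span ℚ (range e)) :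
    h.transport z ∈ (K ⊔ Submodule.span ℚ (range c')) ⊔ Submodule.span ℚ (range e') := by
  obtain ⟨d, hd, y, hy, rfl⟩ := Submodule.mem_sup.1 hz
  obtain ⟨q, rfl⟩ := (Submodule.mem_span_range_iff_exists_fun ℚ).1 hy
  have hd' : d ∈ K ⊔ Submodule.span ℚ (range (Fin.append c e)) := by
    rw [ZilberHomogeneity.range_append, Submodule.span_union, ← sup_assoc]; exact Submodule.mem_sup_left hd
  have hy' : (∑ j, q j • e j) ∈ K ⊔ Submodule.span ℚ (range (Fin.append c e)) := by
    rw [ZilberHomogeneity.range_append, Submodule.span_union, ← sup_assoc]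
    exact Submodule.mem_sup_right (Submodule.sum_mem _ fun j _ =>
      Submodule.smul_mem _ _ (Submodule.subset_span (mem_range_self j)))
  rw [h.transport_add hd' hy', h.transport_sum_smul_right]
  exact add_mem (Submodule.mem_sup_left (h.transport_mem_left hd)) (Submodule.mem_sup_right
    (Submodule.sum_mem _ fun j _ => Submodule.smul_mem _ _ (Submodule.subset_span (mem_range_self j))))

/-- **Γ-isomorphic extensions have the same transcendence degree over the base**:
`td(e/K + ℚc) = td(e'/K + ℚc')` when `(c, e) ↦ (c', e')` is a Γ-isomorphism over `K`.
[cite: BaysKirby2018ANT, Def. 3.10, Def. 4.1] -/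
theorem IsGammaIso.td_sup_span_eq {e e' : Fin k → F}
    (h : IsGammaIso K (Fin.append c e) (Fin.append c' e')) :
    td (K ⊔ Submodule.span ℚ (range c)) (Submodule.span ℚ (range e)) =
      td (K ⊔ Submodule.span ℚ (range c')) (Submodule.span ℚ (range e')) := by
  have hs := h.symm
  refine h.td_eq_of_transport ?_ ?_ ?_ ?_ (fun z hz => h.transport_mem_left hz)
    (fun z hz => hs.transport_mem_left hz) (fun z hz => ?_) (fun z hz => ?_)
  · rw [ZilberHomogeneity.range_append, Submodule.span_union, ← sup_assoc]; exact le_sup_left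
  · rw [ZilberHomogeneity.range_append, Submodule.span_union]; exact le_sup_right.trans le_sup_right |>.trans' le_rfl
  · rw [ZilberHomogeneity.range_append, Submodule.span_union, ← sup_assoc]; exact le_sup_left
  · rw [ZilberHomogeneity.range_append, Submodule.span_union]; exact le_sup_right.trans le_sup_right |>.trans' le_rfl
  · obtain ⟨q, rfl⟩ := (Submodule.mem_span_range_iff_exists_fun ℚ).1 hz
    rw [h.transport_sum_smul_right]
    exact Submodule.sum_mem _ fun j _ => Submodule.smul_mem _ _ (Submodule.subset_span (mem_range_self j))
  · obtain ⟨q, rfl⟩ := (Submodule.mem_span_range_iff_exists_fun ℚ).1 hz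
    rw [hs.transport_sum_smul_right]
    exact Submodule.sum_mem _ fun j _ => Submodule.smul_mem _ _ (Submodule.subset_span (mem_range_self j))

omit [Literature.ModelTheory.ExponentialFields.ExponentialRing F] in
/-- Linear independence over `K` of `(c, e)` gives linear independence of `e` over `K + ℚc`.
[folklore] -/
theorem LinIndepOver.right_of_append {e : Fin k → F} (h : LinIndepOver K (Fin.append c e)) :
    LinIndepOver (K ⊔ Submodule.span ℚ (range c)) e := by
  intro q hq
  obtain ⟨κ, hκ, y, hy, hsum⟩ := Submodule.mem_sup.1 hq
  obtain ⟨p, rfl⟩ := (Submodule.mem_span_range_iff_exists_fun ℚ).1 hy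
  -- `∑ (-p) c + ∑ q e = κ ∈ K`
  have hrel : (∑ s, Fin.append (-p) q s • Fin.append c e s) ∈ K := by
    rw [Fin.sum_univ_add]
    simp only [Fin.append_left, Fin.append_right, Pi.neg_apply, neg_smul, Finset.sum_neg_distrib]
    have : -∑ i, p i • c i + ∑ j, q j • e j = κ := by rw [← hsum]; abel
    rw [this]; exact hκ
  have h0 := h _ hrel
  funext j
  have := congrFun h0 (Fin.natAdd N j)
  simpa only [Fin.append_right, Pi.zero_apply] using this

omit [Literature.ModelTheory.ExponentialFields.ExponentialRing F] in
/-- For `e` linearly independent over `Λ`, `ldim(ℚe/Λ)` is the length of `e`. [folklore] -/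
theorem ldim_span_eq_of_linIndepOver {Λ : Submodule ℚ F} {e : Fin k → F} (h : LinIndepOver Λ e) :
    ldim Λ (Submodule.span ℚ (range e)) = k := by
  rw [linIndepOver_iff] at h
  rw [ldim, Submodule.map_span, ← range_comp, finrank_span_eq_card h, Fintype.card_fin]

/-- **Γ-isomorphic Γ-algebraic extensions**: if `(c, e) ↦ (c', e')` is a Γ-isomorphism over `K`
with `(c, e)` linearly independent over `K`, then `δ(e'/K + ℚc') = δ(e/K + ℚc)`.
[cite: BaysKirby2018ANT, Def. 4.1] -/
theorem IsGammaIso.predim_sup_span_eq {e e' : Fin k → F}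
    (h : IsGammaIso K (Fin.append c e) (Fin.append c' e')) (hind : LinIndepOver K (Fin.append c e)) :
    predim (K ⊔ Submodule.span ℚ (range c')) (Submodule.span ℚ (range e')) =
      predim (K ⊔ Submodule.span ℚ (range c)) (Submodule.span ℚ (range e)) := by
  have hind' : LinIndepOver K (Fin.append c' e') := h.linIndepOver hind
  rw [predim_def, predim_def, h.td_sup_span_eq, ldim_span_eq_of_linIndepOver hind.right_of_append,
    ldim_span_eq_of_linIndepOver hind'.right_of_append]

end GammaField

/-! ### Embeddings of `k[b]` and `k(b)` along a base embedding, from the ideal of a point -/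

namespace ZilberHomogeneity

variable {k L : Type*} [Field k] [Field L] [Algebra k L] {ι : Type*}

/-- `aevalCod k b` is onto `k[b]` (dot-notation extension of `ZilberFieldHomogeneity.lean`).
[folklore] -/
theorem aevalCod_surjective (b : ι → L) : Function.Surjective (aevalCod k b) := by
  rintro ⟨z, hz⟩
  rw [Algebra.adjoin_range_eq_range_aeval] at hz
  obtain ⟨p, rfl⟩ := hz
  exact ⟨p, rfl⟩

/-- The kernel of `aevalCod k b` is the ideal of `b` over `k`. [folklore] -/
theorem mem_ker_aevalCod_iff (b : ι → L) (p : MvPolynomial ι k) :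
    p ∈ RingHom.ker (aevalCod k b).toRingHom ↔ MvPolynomial.aeval b p = 0 := by
  rw [RingHom.mem_ker, AlgHom.toRingHom_eq_coe, RingHom.coe_coe, ← coe_aevalCod]
  exact ⟨fun h => by rw [h]; rfl, fun h => Subtype.ext h⟩

end ZilberHomogeneity

namespace GammaField

section PointHom

open MvPolynomial ZilberHomogeneity
open scoped IntermediateField.algebraAdjoinAdjoin

variable {k L : Type*} [Field k] [Field L] [Algebra k L] {ι : Type*}

/-- **The homomorphism `k[b] → L` along `σ` with `b ↦ b'`**, defined as soon as every polynomial
relation of `b` over `k` is, after transport of coefficients by `σ`, a relation of `b'`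
(`I(b/k)^σ ⊆ I(b'/σk)`): `p(b) ↦ p^σ(b')`. Built on `ZilberHomogeneity.aevalCod`. [folklore] -/
def pointHom (σ : k →+* L) (b b' : ι → L)
    (hle : ∀ p : MvPolynomial ι k, aeval b p = 0 → eval₂ σ b' p = 0) :
    Algebra.adjoin k (range b) →+* L :=
  (aevalCod k b).toRingHom.liftOfSurjective (aevalCod_surjective b)
    ⟨eval₂Hom σ b', fun p hp => by
      rw [RingHom.mem_ker, coe_eval₂Hom]
      exact hle p ((mem_ker_aevalCod_iff b p).1 hp)⟩

/-- `pointHom σ b b'` sends `p(b) ↦ p^σ(b')`. [folklore] -/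
theorem pointHom_aevalCod (σ : k →+* L) (b b' : ι → L)
    (hle : ∀ p : MvPolynomial ι k, aeval b p = 0 → eval₂ σ b' p = 0) (p : MvPolynomial ι k) :
    pointHom σ b b' hle (aevalCod k b p) = eval₂ σ b' p :=
  (aevalCod k b).toRingHom.liftOfRightInverse_comp_apply _ _ _ p

/-- `pointHom σ b b'` on an element `p(b)` of `k[b]` given with any membership proof. [folklore] -/
theorem pointHom_apply_aeval (σ : k →+* L) (b b' : ι → L)
    (hle : ∀ p : MvPolynomial ι k, aeval b p = 0 → eval₂ σ b' p = 0) (p : MvPolynomial ι k)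
    (hp : aeval b p ∈ Algebra.adjoin k (range b)) :
    pointHom σ b b' hle ⟨aeval b p, hp⟩ = eval₂ σ b' p :=
  pointHom_aevalCod σ b b' hle p

/-- `pointHom σ b b'` is `σ` on `k`. [folklore] -/
theorem pointHom_algebraMap (σ : k →+* L) (b b' : ι → L)
    (hle : ∀ p : MvPolynomial ι k, aeval b p = 0 → eval₂ σ b' p = 0) (z : k) :
    pointHom σ b b' hle (algebraMap k _ z) = σ z := by
  have : algebraMap k (Algebra.adjoin k (range b)) z = aevalCod k b (C z) :=
    Subtype.ext (by simp)
  rw [this, pointHom_aevalCod, eval₂_C]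

/-- `pointHom σ b b'` sends `bᵢ ↦ b'ᵢ`. [folklore] -/
theorem pointHom_apply_self (σ : k →+* L) (b b' : ι → L)
    (hle : ∀ p : MvPolynomial ι k, aeval b p = 0 → eval₂ σ b' p = 0) (i : ι) :
    pointHom σ b b' hle ⟨b i, Algebra.subset_adjoin (mem_range_self i)⟩ = b' i := by
  have : (⟨b i, Algebra.subset_adjoin (mem_range_self i)⟩ : Algebra.adjoin k (range b)) =
      aevalCod k b (X i) := Subtype.ext (by simp)
  rw [this, pointHom_aevalCod, eval₂_X]

/-- If conversely every relation of `b'` comes from one of `b` (`I(b/k)^σ = I(b'/σk)`), then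
`pointHom σ b b'` is injective. [folklore] -/
theorem pointHom_injective (σ : k →+* L) (b b' : ι → L)
    (hiff : ∀ p : MvPolynomial ι k, aeval b p = 0 ↔ eval₂ σ b' p = 0) :
    Function.Injective (pointHom σ b b' fun p => (hiff p).1) := by
  rw [injective_iff_map_eq_zero]
  intro z hz
  obtain ⟨p, rfl⟩ := aevalCod_surjective b z
  rw [pointHom_aevalCod] at hz
  exact Subtype.ext ((hiff p).2 hz)

/-- **The field embedding `k(b) → L` along `σ` with `b ↦ b'`** when `b` and `b'` have
corresponding ideals (`I(b/k)^σ = I(b'/σk)`): the extension of `pointHom` to the fraction field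
`k(b)` of `k[b]`. [folklore] -/
def pointFieldHom (σ : k →+* L) (b b' : ι → L)
    (hiff : ∀ p : MvPolynomial ι k, aeval b p = 0 ↔ eval₂ σ b' p = 0) :
    IntermediateField.adjoin k (range b) →+* L :=
  IsFractionRing.lift (A := Algebra.adjoin k (range b)) (pointHom_injective σ b b' hiff)

/-- `pointFieldHom` extends `pointHom`. [folklore] -/
theorem pointFieldHom_of_mem_adjoin (σ : k →+* L) (b b' : ι → L)
    (hiff : ∀ p : MvPolynomial ι k, aeval b p = 0 ↔ eval₂ σ b' p = 0) {z : L}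
    (hz : z ∈ Algebra.adjoin k (range b)) :
    pointFieldHom σ b b' hiff ⟨z, IntermediateField.algebra_adjoin_le_adjoin _ _ hz⟩ =
      pointHom σ b b' (fun p => (hiff p).1) ⟨z, hz⟩ := by
  have := IsFractionRing.lift_algebraMap (A := Algebra.adjoin k (range b))
    (K := IntermediateField.adjoin k (range b)) (pointHom_injective σ b b' hiff) ⟨z, hz⟩
  exact this

/-- `pointFieldHom` sends `p(b) ↦ p^σ(b')`. [folklore] -/
theorem pointFieldHom_apply_aeval (σ : k →+* L) (b b' : ι → L)
    (hiff : ∀ p : MvPolynomial ι k, aeval b p = 0 ↔ eval₂ σ b' p = 0) (p : MvPolynomial ι k)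
    (hp : aeval b p ∈ IntermediateField.adjoin k (range b)) :
    pointFieldHom σ b b' hiff ⟨aeval b p, hp⟩ = eval₂ σ b' p := by
  have hp' : aeval b p ∈ Algebra.adjoin k (range b) := (aevalCod k b p).2
  rw [show (⟨aeval b p, hp⟩ : IntermediateField.adjoin k (range b)) =
    ⟨aeval b p, IntermediateField.algebra_adjoin_le_adjoin _ _ hp'⟩ from rfl,
    pointFieldHom_of_mem_adjoin σ b b' hiff hp', pointHom_apply_aeval]

/-- `pointFieldHom` is `σ` on `k`. [folklore] -/
theorem pointFieldHom_algebraMap (σ : k →+* L) (b b' : ι → L)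
    (hiff : ∀ p : MvPolynomial ι k, aeval b p = 0 ↔ eval₂ σ b' p = 0) (z : k) :
    pointFieldHom σ b b' hiff (algebraMap k _ z) = σ z := by
  have hz : algebraMap k L z ∈ Algebra.adjoin k (range b) := (Algebra.adjoin k (range b)).algebraMap_mem z
  rw [show algebraMap k (IntermediateField.adjoin k (range b)) z =
    ⟨algebraMap k L z, IntermediateField.algebra_adjoin_le_adjoin _ _ hz⟩ from rfl,
    pointFieldHom_of_mem_adjoin]
  exact pointHom_algebraMap σ b b' _ z

/-- `pointFieldHom` sends `bᵢ ↦ b'ᵢ`. [folklore] -/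
theorem pointFieldHom_apply_self (σ : k →+* L) (b b' : ι → L)
    (hiff : ∀ p : MvPolynomial ι k, aeval b p = 0 ↔ eval₂ σ b' p = 0) (i : ι) :
    pointFieldHom σ b b' hiff ⟨b i, IntermediateField.subset_adjoin _ _ (mem_range_self i)⟩ = b' i := by
  rw [show (⟨b i, IntermediateField.subset_adjoin _ _ (mem_range_self i)⟩ :
      IntermediateField.adjoin k (range b)) =
    ⟨b i, IntermediateField.algebra_adjoin_le_adjoin _ _ (Algebra.subset_adjoin (mem_range_self i))⟩
    from rfl, pointFieldHom_of_mem_adjoin]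
  exact pointHom_apply_self σ b b' _ i

/-- `pointFieldHom` is injective (a homomorphism of fields). [folklore] -/
theorem pointFieldHom_injective (σ : k →+* L) (b b' : ι → L)
    (hiff : ∀ p : MvPolynomial ι k, aeval b p = 0 ↔ eval₂ σ b' p = 0) :
    Function.Injective (pointFieldHom σ b b' hiff) :=
  (pointFieldHom σ b b' hiff).injective

end PointHom

end GammaField

end Literature.NumberTheory.Transcendental
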